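import Mathlib.Analysis.SpecialFunctions.Trigonometric.Bounds
import Literature.Geometry.Lorentzian.CarterFarEnvelope
import HarnessLib

/-!
# Far asymptotics in the Kerr tortoise coordinate: the phase `t̄(r) = r + 2M log r + O(M²/r)`
# and the `r*`-tail `∫_r^∞ |V| dr* ≤ 6(1 + Λ)/r` of Carter's potential, uniformly in `|a| < M`

(namespace `Literature.Geometry.Lorentzian.Kerr`.) Two elementary, `a`-UNIFORM far-zone facts about
the tortoise coordinate of sub-extremal Kerr (Dafermos–Rodnianski–Shlapentokh-Rothman,
arXiv:1402.7034, §2.1.2: `dr*/dr = (r² + a²)/Δ`; the tree's primitive is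
`Kerr.starTime M a r = r + (2Mr₊/(r₊ − r₋)) log(r − r₊) − (2Mr₋/(r₊ − r₋)) log(r − r₋)`, inverted by
`Kerr.tortoiseRadius`), needed to turn the abstract Jost estimate
`Literature.Analysis.ODE.jost_outgoing_remainder` into the quantitative outgoing asymptotics of the
infinity-normalised Teukolsky solution (`TeukolskyJostRemainderBound.lean`):

* `abs_starTime_sub_le` — `|t̄(r) − (r + 2M log r)| ≤ 16M²/r` for `r ≥ 8M`: the coefficients
  `2Mr_±/(r₊ − r₋)` blow up as `|a| → M`, but
  `t̄ − r − 2M log r = 2M log(1 − r₊/r) + (2Mr₋/(r₊ − r₋)) log((r − r₊)/(r − r₋))` and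
  `|log y| ≤ 2(1 − y)` on `[1/2, 1]` bound the two terms by `8M²/r` and `4Mr₋/(r − r₋) ≤ 5M²/r`;
  hence `norm_cexp_starTime_sub_le`: `‖e^{iω t̄(r)} − e^{iωr + 2iMω log r}‖ ≤ 16M²|ω|/r` — the phase
  `e^{iωr} r^{2iMω}` of Teixeira da Costa's Def. 2.3 IS `e^{iωr*}` up to `O(M²|ω|/r)` for THIS `r*`;
* `IsTortoiseRadius.integral_abs_sepPotential_le` — along any tortoise radius function `ρ` and for an
  admissible triple, `V ∘ ρ` is integrable on `(x, ∞)` with `∫_{(x,∞)} |V(ρ t)| dt ≤ 6(1 + Λ)/ρ x` once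
  `ρ x ≥ 4M` (`|V| ≤ 3(1 + Λ)/r²`, `Kerr.abs_sepPotential_le`, and `dρ/dx = Δ/(ρ² + a²) ≥ 1/2`, so
  `|V ∘ ρ| ≤ d/dx[−6(1 + Λ)/ρ]`);
* small helpers: `half_le_delta_div_of_four_mul_le`,
  `abs_sepPotential_le_inv_sq`, `IsTortoiseRadius.continuous_sepPotential_comp`,
  `tortoiseRadius_starTime` (`ρ(t̄(r)) = r`).

Everything is proved; theorems only.

## References
* M. Dafermos, I. Rodnianski, Y. Shlapentokh-Rothman, *Decay for solutions of the wave equation on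
  Kerr exterior spacetimes III*, arXiv:1402.7034 = Ann. of Math. 183 (2016), §2.1.2 (`r*`), §8.4
  ((someBoundS): `|V| ≲ Λ r⁻² + r⁻³`). [DafermosRodnianskiShlapentokhrothman2014]
-/

noncomputable section

open Complex Set Filter MeasureTheory
open scoped _root_.Topology

namespace Literature.Geometry.Lorentzian.Kerr

/-! ### The tortoise phase versus `ωr + 2Mω log r` -/

/-- **The tortoise primitive is `r + 2M log r + O(M²/r)`**: for `|a| < M` and `r ≥ 8M`,
`|t̄(r) − (r + 2M log r)| ≤ 16M²/r`, where `t̄ = Kerr.starTime M a` is the logarithmic primitive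
`r + (2Mr₊/(r₊ − r₋)) log(r − r₊) − (2Mr₋/(r₊ − r₋)) log(r − r₋)` of `(r² + a²)/Δ` (DRSR §2.1.2). The
identity `t̄ − r − 2M log r = 2M log(1 − r₊/r) + (2Mr₋/(r₊ − r₋)) log((r − r₊)/(r − r₋))` and
`|log y| ≤ 2(1 − y)` on `[1/2, 1]` give the two bounds `8M²/r` and `4Mr₋/(r − r₋) ≤ 5M²/r`, UNIFORM in
`a` (the `(r₊ − r₋)⁻¹` cancels). [cite: DafermosRodnianskiShlapentokhrothman2014, §2.1.2] -/
theorem abs_starTime_sub_le {M a : ℝ} (hMa : IsSubextremal M a) {r : ℝ} (hr : 8 * M ≤ r) :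
    |starTime M a r - (r + 2 * M * Real.log r)| ≤ 16 * M ^ 2 / r := by
  have hM : 0 < M := hMa.pos
  set p := rPlus M a with hp
  set q := rMinus M a with hq
  have hpq : q < p := hMa.rMinus_lt_rPlus
  have hd : 0 < p - q := sub_pos.2 hpq
  have hp2 : p ≤ 2 * M := rPlus_le_two_mul_self hM.le a
  have hp0 : 0 < p := rPlus_pos hM a
  have hq0 : 0 ≤ q := hMa.rMinus_nonneg
  have hqM : q ≤ M := by rw [hq]; unfold rMinus; linarith [Real.sqrt_nonneg (M ^ 2 - a ^ 2)]
  have hr0 : 0 < r := by linarith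
  have hrp : 0 < r - p := by linarith
  have hrq : 0 < r - q := by linarith
  -- `|log y| ≤ 2(1 − y)` on `[1/2, 1]` (`1 − y⁻¹ ≤ log y ≤ 0`)
  have hlog : ∀ y : ℝ, 1 / 2 ≤ y → y ≤ 1 → |Real.log y| ≤ 2 * (1 - y) := fun y h1 h2 ↦ by
    have hy : 0 < y := by linarith
    have hlo := Real.one_sub_inv_le_log_of_pos hy
    have hup : Real.log y ≤ 0 := Real.log_nonpos hy.le h2
    have hinv : y⁻¹ ≤ 1 + 2 * (1 - y) := by
      rw [inv_le_iff_one_le_mul₀ hy]; nlinarith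
    rw [abs_le]; constructor <;> linarith
  -- the identity
  have hid : starTime M a r - (r + 2 * M * Real.log r) =
      2 * M * Real.log ((r - p) / r) + 2 * M * q / (p - q) * Real.log ((r - p) / (r - q)) := by
    rw [Real.log_div hrp.ne' hr0.ne', Real.log_div hrp.ne' hrq.ne']
    unfold starTime
    rw [← hp, ← hq]
    field_simp
    ring
  -- the two logarithms
  have hy1 : |Real.log ((r - p) / r)| ≤ 2 * (p / r) := by
    have e : 1 - (r - p) / r = p / r := by field_simp; ring
    rw [← e]
    refine hlog _ ?_ ?_
    · rw [le_div_iff₀ hr0]; linarith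
    · rw [div_le_one hr0]; linarith
  have hy2 : |Real.log ((r - p) / (r - q))| ≤ 2 * ((p - q) / (r - q)) := by
    have e : 1 - (r - p) / (r - q) = (p - q) / (r - q) := by field_simp; ring
    rw [← e]
    refine hlog _ ?_ ?_
    · rw [le_div_iff₀ hrq]; linarith
    · rw [div_le_one hrq]; linarith
  have hA : 0 ≤ 2 * M * q / (p - q) := by positivity
  rw [hid]
  calc |2 * M * Real.log ((r - p) / r) + 2 * M * q / (p - q) * Real.log ((r - p) / (r - q))|
      ≤ |2 * M * Real.log ((r - p) / r)| + |2 * M * q / (p - q) * Real.log ((r - p) / (r - q))| :=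
        abs_add_le _ _
    _ = 2 * M * |Real.log ((r - p) / r)| + 2 * M * q / (p - q) * |Real.log ((r - p) / (r - q))| := by
        rw [abs_mul, abs_of_pos (by positivity : (0 : ℝ) < 2 * M), abs_mul, abs_of_nonneg hA]
    _ ≤ 2 * M * (2 * (p / r)) + 2 * M * q / (p - q) * (2 * ((p - q) / (r - q))) := by gcongr
    _ = 4 * M * p / r + 4 * M * q / (r - q) := by field_simp; norm_num
    _ ≤ 4 * M * (2 * M) / r + 4 * M * M / (7 * r / 8) := by
        gcongr 4 * M * ?_ / r + ?_
        · exact div_le_div₀ (by positivity) (by nlinarith) (by positivity) (by linarith)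
    _ ≤ 16 * M ^ 2 / r := by
        rw [div_add_div _ _ hr0.ne' (by positivity), div_le_div_iff₀ (by positivity) hr0]
        nlinarith [mul_pos hM hr0, mul_pos (mul_pos hM hM) (mul_pos hr0 hr0)]

/-- **Phase comparison**: for `|a| < M`, `r ≥ 8M` and real `ω`,
`‖e^{iω t̄(r)} − e^{iωr + 2iMω log r}‖ ≤ 16M²|ω|/r` (`|e^{iθ₁} − e^{iθ₂}| ≤ |θ₁ − θ₂|` and
`abs_starTime_sub_le`). [cite: DafermosRodnianskiShlapentokhrothman2014, §2.1.2] -/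
theorem norm_cexp_starTime_sub_le {M a : ℝ} (hMa : IsSubextremal M a) (ω : ℝ) {r : ℝ} (hr : 8 * M ≤ r) :
    ‖Complex.exp (I * ω * (starTime M a r : ℝ)) - Complex.exp (I * ω * r + 2 * I * M * ω * Real.log r)‖ ≤
      16 * M ^ 2 * |ω| / r := by
  have hM : 0 < M := hMa.pos
  have hr0 : 0 < r := by linarith
  set θ₁ : ℝ := ω * starTime M a r with hθ₁
  set θ₂ : ℝ := ω * r + 2 * M * ω * Real.log r with hθ₂
  have e1 : Complex.exp (I * ω * (starTime M a r : ℝ)) = Complex.exp (I * θ₁) := by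
    rw [hθ₁]; push_cast; ring_nf
  have e2 : Complex.exp (I * ω * r + 2 * I * M * ω * Real.log r) = Complex.exp (I * θ₂) := by
    rw [hθ₂]; push_cast; ring_nf
  have e3 : Complex.exp (I * θ₁) - Complex.exp (I * θ₂) =
      Complex.exp (I * θ₂) * (Complex.exp (I * ((θ₁ - θ₂ : ℝ) : ℂ)) - 1) := by
    rw [mul_sub, mul_one, ← Complex.exp_add]; push_cast; ring_nf
  rw [e1, e2, e3, norm_mul, Complex.norm_exp_I_mul_ofReal, one_mul]
  refine (Real.norm_exp_I_mul_ofReal_sub_one_le).trans ?_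
  rw [Real.norm_eq_abs, hθ₁, hθ₂]
  have e4 : ω * starTime M a r - (ω * r + 2 * M * ω * Real.log r) =
      ω * (starTime M a r - (r + 2 * M * Real.log r)) := by ring
  rw [e4, abs_mul]
  calc |ω| * |starTime M a r - (r + 2 * M * Real.log r)| ≤ |ω| * (16 * M ^ 2 / r) :=
        mul_le_mul_of_nonneg_left (abs_starTime_sub_le hMa hr) (abs_nonneg ω)
    _ = 16 * M ^ 2 * |ω| / r := by ring

/-! ### The tail of the potential along `r*` -/

/-- `Δ/(r² + a²) ≥ 1/2` for `r ≥ 4M` (`|a| ≤ M` not even needed: `r² − 4Mr + a² ≥ 0`). [folklore] -/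
theorem half_le_delta_div_of_four_mul_le {M a r : ℝ} (hM : 0 < M) (hr : 4 * M ≤ r) :
    1 / 2 ≤ delta M a r / (r ^ 2 + a ^ 2) := by
  have hr0 : 0 < r := by linarith
  rw [div_le_div_iff₀ (by norm_num) (by positivity)]
  unfold delta
  nlinarith [sq_nonneg a, mul_nonneg hr0.le (sub_nonneg.2 hr)]

/-- `|V(r)| ≤ 3(1 + Λ)/r²` on `r ≥ r₊` (`0 < M`, `|a| ≤ M`, admissible triple): `Kerr.abs_sepPotential_le`
with `3M/r³ ≤ 3/r²` (`r ≥ r₊ ≥ M`). [cite: DafermosRodnianskiShlapentokhrothman2014, §8.4] -/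
theorem abs_sepPotential_le_inv_sq {M a ω Λ r : ℝ} {m : ℤ} (hM : 0 < M) (haM : |a| ≤ M)
    (hadm : IsAdmissibleTriple a ω m Λ) (hr : rPlus M a ≤ r) :
    |sepPotential M a ω m Λ r| ≤ 3 * (1 + Λ) / r ^ 2 := by
  have hMr : M ≤ r := (M_le_rPlus M a).trans hr
  have hr0 : 0 < r := hM.trans_le hMr
  have h := abs_sepPotential_le hM haM hadm hr
  have h3 : 3 * M / r ^ 3 ≤ 3 / r ^ 2 := by
    rw [div_le_div_iff₀ (by positivity) (by positivity)]
    nlinarith [mul_pos hr0 hr0]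
  calc |sepPotential M a ω m Λ r| ≤ 3 * Λ / r ^ 2 + 3 * M / r ^ 3 := h
    _ ≤ 3 * Λ / r ^ 2 + 3 / r ^ 2 := by linarith
    _ = 3 * (1 + Λ) / r ^ 2 := by ring

namespace IsTortoiseRadius

variable {M a ω Λ : ℝ} {m : ℤ} {ρ : ℝ → ℝ}

/-- `V ∘ ρ` is continuous along a tortoise radius function. [folklore] -/
theorem continuous_sepPotential_comp (hρ : IsTortoiseRadius M a ρ) (hMa : IsSubextremal M a)
    (ω : ℝ) (m : ℤ) (Λ : ℝ) : Continuous fun x ↦ sepPotential M a ω m Λ (ρ x) := by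
  have h : Continuous fun x ↦ ω ^ 2 - sepPotential M a ω m Λ (ρ x) :=
    continuous_iff_continuousAt.2 fun x ↦
      (hρ.hasDerivAt_omega_sq_sub_sepPotential hMa ω m Λ x).continuousAt
  have e : (fun x ↦ sepPotential M a ω m Λ (ρ x)) =
      fun x ↦ ω ^ 2 - (ω ^ 2 - sepPotential M a ω m Λ (ρ x)) := by funext x; ring
  rw [e]
  exact continuous_const.sub h

/-- **The potential is integrable along `r*` beyond `r = 4M`, with tail `≤ 6(1 + Λ)/r`**: for a
tortoise radius function `ρ` (`|a| < M`), an admissible triple and `x` with `ρ x ≥ 4M`,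
`V ∘ ρ` is integrable on `(x, ∞)` and `∫_{(x,∞)} |V(ρ t)| dt ≤ 6(1 + Λ)/ρ x` — since
`|V(ρ t)| ≤ 3(1 + Λ)/ρ² ≤ 6(1 + Λ)·ρ′/ρ² = d/dt[−6(1 + Λ)/ρ]` (`ρ′ = Δ/(ρ² + a²) ≥ 1/2`), i.e.
`∫_r^∞ |V| dr* ≤ 2∫_r^∞ 3(1 + Λ) dr/r²`. [cite: DafermosRodnianskiShlapentokhrothman2014, §8.4] -/
theorem integral_abs_sepPotential_le (hρ : IsTortoiseRadius M a ρ) (hMa : IsSubextremal M a)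
    (hadm : IsAdmissibleTriple a ω m Λ) {x : ℝ} (hx : 4 * M ≤ ρ x) :
    IntegrableOn (fun t ↦ sepPotential M a ω m Λ (ρ t)) (Ioi x) ∧
      ∫ t in Ioi x, |sepPotential M a ω m Λ (ρ t)| ≤ 6 * (1 + Λ) / ρ x := by
  have hM : 0 < M := hMa.pos
  have hΛ : 0 ≤ Λ := hadm.nonneg
  set f : ℝ → ℝ := fun t ↦ sepPotential M a ω m Λ (ρ t) with hf
  have hfc : Continuous f := hρ.continuous_sepPotential_comp hMa ω m Λ
  set G : ℝ → ℝ := fun t ↦ -(6 * (1 + Λ)) / ρ t with hG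
  set G' : ℝ → ℝ := fun t ↦ 6 * (1 + Λ) * (delta M a (ρ t) / (ρ t ^ 2 + a ^ 2)) / ρ t ^ 2 with hG'
  have hGd : ∀ t, HasDerivAt G (G' t) t := fun t ↦ by
    have hρ0 : ρ t ≠ 0 := (hρ.pos hMa t).ne'
    refine ((hasDerivAt_const t (-(6 * (1 + Λ)))).div (hρ.hasDerivAt t) hρ0).congr_deriv ?_
    simp only [hG']
    ring
  have hΔc : Continuous fun r ↦ delta M a r := by unfold delta; fun_prop
  have hG'c : Continuous G' :=
    ((continuous_const.mul ((hΔc.comp' hρ.continuous).div ((hρ.continuous.pow 2).add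
      continuous_const) fun t ↦ (hρ.sq_add_sq_pos hMa t).ne')).div (hρ.continuous.pow 2)
      fun t ↦ pow_ne_zero 2 (hρ.pos hMa t).ne')
  -- pointwise: `|f t| ≤ G' t` for `t ≥ x`
  have hle : ∀ t, x ≤ t → |f t| ≤ G' t := fun t ht ↦ by
    have h4 : 4 * M ≤ ρ t := hx.trans ((hρ.strictMono hMa).monotone ht)
    have hρ0 : 0 < ρ t := hρ.pos hMa t
    have hV := abs_sepPotential_le_inv_sq (ω := ω) (Λ := Λ) (m := m) hM hMa.le hadm (hρ.rPlus_lt t).le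
    have hD := half_le_delta_div_of_four_mul_le (a := a) hM h4
    simp only [hG']
    calc |f t| ≤ 3 * (1 + Λ) / ρ t ^ 2 := hV
      _ = 6 * (1 + Λ) * (1 / 2) / ρ t ^ 2 := by ring
      _ ≤ 6 * (1 + Λ) * (delta M a (ρ t) / (ρ t ^ 2 + a ^ 2)) / ρ t ^ 2 := by gcongr
  -- partial integrals are bounded by `6(1+Λ)/ρ x`
  have hpart : ∀ T, x ≤ T → ∫ t in x..T, |f t| ≤ 6 * (1 + Λ) / ρ x := fun T hT ↦ by
    have h1 : ∫ t in x..T, |f t| ≤ ∫ t in x..T, G' t :=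
      intervalIntegral.integral_mono_on hT (hfc.abs.intervalIntegrable _ _)
        (hG'c.intervalIntegrable _ _) fun t ht ↦ hle t ht.1
    have h2 : ∫ t in x..T, G' t = G T - G x :=
      intervalIntegral.integral_eq_sub_of_hasDerivAt (fun t _ ↦ hGd t) (hG'c.intervalIntegrable _ _)
    have h3 : G T ≤ 0 := by
      simp only [hG]
      exact div_nonpos_of_nonpos_of_nonneg (by nlinarith) (hρ.pos hMa T).le
    have h4 : -G x = 6 * (1 + Λ) / ρ x := by simp only [hG]; ring
    linarith
  have hfi : IntegrableOn f (Ioi x) := by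
    refine integrableOn_Ioi_of_intervalIntegral_norm_bounded (6 * (1 + Λ) / ρ x) x (l := atTop)
      (b := id) (fun T ↦ hfc.integrableOn_Ioc) tendsto_id ?_
    filter_upwards [eventually_ge_atTop x] with T hT
    simpa only [Real.norm_eq_abs, id_eq] using hpart T hT
  refine ⟨hfi, ?_⟩
  have hlim := intervalIntegral_tendsto_integral_Ioi x (hfi.abs) tendsto_id
  exact le_of_tendsto hlim (by
    filter_upwards [eventually_ge_atTop x] with T hT
    simpa only [id_eq] using hpart T hT)

end IsTortoiseRadius

/-- `ρ(t̄(r)) = r` for `r > r₊`, where `ρ = Kerr.tortoiseRadius` inverts the tortoise primitive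
`t̄ = Kerr.starTime M a`. [cite: DafermosRodnianskiShlapentokhrothman2014, §2.1.2] -/
theorem tortoiseRadius_starTime {M a : ℝ} (hMa : IsSubextremal M a) {r : ℝ} (hr : rPlus M a < r) :
    tortoiseRadius hMa (starTime M a r) = r := by
  obtain ⟨y, hy⟩ := (isTortoiseRadius_tortoiseRadius hMa).exists_apply_eq hr
  rw [← hy, starTime_tortoiseRadius]

end Literature.Geometry.Lorentzian.Kerr

end
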